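import Mathlib
import Summits.QuantumFields.QCD.Theorems.QuarksAsStableActionUnquenchedChessboardBoundStubSitePeelGram
import Summits.QuantumFields.QCD.Theorems.QuarksAsStableActionUnquenchedChessboardBoundStubMarginalRPFeatures
import HarnessLib

/-!
# Positivity, regularity and locality of the diluted Gram kernel and features (stubs
`stub_torusPeel` / `stub_sitePeel` of crux stmt-QuantumFields-9735, line Sketch — wave-2 helper 2)

Dilution only switches hops off, so the positivity mechanism of the undiluted plane operator
(helper file 6 of `stub_marginalRP`) survives: with the bond projections `Π_k^E` (`bondDiag`) the
masked spin-diagonal spatial Wilson operator is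
`(m + 4)·1 - ½ Σ_k (Π_k T_k + (Π_k T_k)ᴴ) = (m + 1)·1 + ½ Σ_k [(1 - Π_k T_k)ᴴ(1 - Π_k T_k) + ((1 - Π_k) T_k)ᴴ ((1 - Π_k) T_k)]`
(`sdOpE_eq_pos`), positive semidefinite for `m ≥ -1` (`posSemidef_sdOpE`); its entries are the
masked entries of the undiluted one (`sdOpE_apply`), so the masked plane block is a masked principal
submatrix (`planeBlockE_eq`) and **`posSemidef_gramKernelE`** follows. The masked blocks inherit
continuity and locality from the undiluted ones.
-/

noncomputable section

open Matrix Complex Finset MeasureTheory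
open Literature.MathematicalPhysics.QuantumLattice Literature.MathematicalPhysics.QuantumFieldTheory
open Literature.Probability.LatticeModels
open Summit.QuantumFields.QCD.Theorems.QuarksAsStableAction
open scoped ComplexConjugate BigOperators Kronecker ComplexOrder

namespace Summit.QuantumFields.QCD.Theorems.UnquenchedChessboardBoundLine

/-! ## The masked spatial Wilson operator -/

section Hop

variable {L N : ℕ} [NeZero L] [Fact (1 < L)]

omit [NeZero L] [Fact (1 < L)] in
/-- The bond projection `Π_k^E = diag [(x, k) ∈ E]` (on the source site of the hop). -/
def bondDiag (E : Finset (Edge 4 L)) (k : Fin 4) :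
    Matrix (TorusSite 4 L × Fin N × Fin 4) (TorusSite 4 L × Fin N × Fin 4) ℂ :=
  diagonal fun p => if (p.1, k) ∈ E then 1 else 0

omit [NeZero L] [Fact (1 < L)] in
/-- `Π_kᴴ = Π_k`. -/
theorem bondDiag_conjTranspose (E : Finset (Edge 4 L)) (k : Fin 4) :
    (bondDiag (N := N) E k)ᴴ = bondDiag E k := by
  rw [bondDiag, diagonal_conjTranspose]
  congr 1
  funext p
  simp only [Pi.star_apply, apply_ite star, star_one, star_zero]

omit [Fact (1 < L)] in
/-- `Π_k² = Π_k`. -/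
theorem bondDiag_mul_self (E : Finset (Edge 4 L)) (k : Fin 4) :
    bondDiag (N := N) E k * bondDiag E k = bondDiag E k := by
  rw [bondDiag, diagonal_mul_diagonal]
  congr 1
  funext p
  split_ifs <;> simp

omit [Fact (1 < L)] in
/-- The masked hop `Π_k^E T_k`. -/
def hopTE (E : Finset (Edge 4 L)) (V : GaugeConfig 4 L (Matrix.unitaryGroup (Fin N) ℂ)) (k : Fin 4) :
    Matrix (TorusSite 4 L × Fin N × Fin 4) (TorusSite 4 L × Fin N × Fin 4) ℂ :=
  bondDiag E k * hopT V k

omit [Fact (1 < L)] in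
/-- The masked spin-diagonal spatial Wilson operator `(m + 4)·1 - ½ Σ_{k ≠ 0} (Π_k T_k + (Π_k T_k)ᴴ)`. -/
def sdOpE (E : Finset (Edge 4 L)) (V : GaugeConfig 4 L (Matrix.unitaryGroup (Fin N) ℂ)) (m : ℝ) :
    Matrix (TorusSite 4 L × Fin N × Fin 4) (TorusSite 4 L × Fin N × Fin 4) ℂ :=
  ((m + 4 : ℝ) : ℂ) • 1 - (1 / 2 : ℂ) • ∑ k ∈ Finset.univ.erase (0 : Fin 4), (hopTE E V k + (hopTE E V k)ᴴ)

omit [Fact (1 < L)] in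
/-- The key algebraic identity `(1 - ΠT)ᴴ(1 - ΠT) + ((1 - Π)T)ᴴ((1 - Π)T) = 2·1 - (ΠT + (ΠT)ᴴ)` for a
projection `Π` and an isometry `T`. -/
theorem hopTE_square_identity (E : Finset (Edge 4 L)) (V : GaugeConfig 4 L (Matrix.unitaryGroup (Fin N) ℂ)) (k : Fin 4) :
    (1 - hopTE E V k)ᴴ * (1 - hopTE E V k) +
        ((1 - bondDiag E k) * hopT V k)ᴴ * ((1 - bondDiag E k) * hopT V k) =
      (2 : ℂ) • 1 - (hopTE E V k + (hopTE E V k)ᴴ) := by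
  set D := bondDiag (N := N) E k with hDdef
  set T := hopT V k with hTdef
  have hD : Dᴴ = D := bondDiag_conjTranspose E k
  have hDD : D * D = D := bondDiag_mul_self E k
  have hT : Tᴴ * T = 1 := hopT_conjTranspose_mul_self V k
  have h1 : (1 - hopTE E V k)ᴴ * (1 - hopTE E V k) = 1 - D * T - Tᴴ * D + Tᴴ * (D * T) := by
    simp only [hopTE, ← hDdef, ← hTdef]
    rw [conjTranspose_sub, conjTranspose_one, conjTranspose_mul, hD, Matrix.sub_mul, Matrix.mul_sub,
      Matrix.mul_sub, Matrix.one_mul, Matrix.one_mul, Matrix.mul_one, Matrix.mul_assoc, ← Matrix.mul_assoc D D T, hDD]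
    abel
  have h2 : ((1 - D) * T)ᴴ * ((1 - D) * T) = 1 - Tᴴ * (D * T) := by
    rw [conjTranspose_mul, conjTranspose_sub, conjTranspose_one, hD, Matrix.mul_assoc,
      ← Matrix.mul_assoc (1 - D) (1 - D) T,
      show (1 - D) * (1 - D) = 1 - D by rw [Matrix.sub_mul, Matrix.one_mul, Matrix.mul_sub, Matrix.mul_one, hDD, sub_self, sub_zero],
      Matrix.sub_mul, Matrix.one_mul, Matrix.mul_sub, hT]
  rw [h1, h2]
  simp only [hopTE, ← hDdef, ← hTdef, conjTranspose_mul, hD, two_smul]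
  abel

omit [Fact (1 < L)] in
/-- **The manifestly positive form** of the masked operator. -/
theorem sdOpE_eq_pos (E : Finset (Edge 4 L)) (V : GaugeConfig 4 L (Matrix.unitaryGroup (Fin N) ℂ)) (m : ℝ) :
    sdOpE E V m = ((m + 1 : ℝ) : ℂ) • 1 + (1 / 2 : ℂ) • ∑ k ∈ Finset.univ.erase (0 : Fin 4),
      ((1 - hopTE E V k)ᴴ * (1 - hopTE E V k) + ((1 - bondDiag E k) * hopT V k)ᴴ * ((1 - bondDiag E k) * hopT V k)) := by
  simp only [sdOpE, hopTE_square_identity, Finset.sum_sub_distrib, Finset.sum_const,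
    Finset.card_erase_of_mem (Finset.mem_univ _), Finset.card_univ, Fintype.card_fin, smul_sub]
  rw [← Nat.cast_smul_eq_nsmul ℂ, smul_smul, smul_smul, ← add_sub_assoc, ← add_smul]
  congr 2
  push_cast
  ring

omit [Fact (1 < L)] in
/-- **Positivity for `m ≥ -1`.** -/
theorem posSemidef_sdOpE (E : Finset (Edge 4 L)) (V : GaugeConfig 4 L (Matrix.unitaryGroup (Fin N) ℂ)) {m : ℝ}
    (hm : -1 ≤ m) : (sdOpE E V m).PosSemidef := by
  rw [sdOpE_eq_pos]
  refine Matrix.PosSemidef.add (Matrix.PosSemidef.one.smul ?_) ((Matrix.posSemidef_sum _ fun k _ =>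
    (Matrix.posSemidef_conjTranspose_mul_self _).add (Matrix.posSemidef_conjTranspose_mul_self _)).smul ?_)
  · exact Complex.zero_le_real.2 (by linarith)
  · rw [show (1 / 2 : ℂ) = ((1 / 2 : ℝ) : ℂ) by push_cast; ring]
    exact Complex.zero_le_real.2 (by norm_num)

omit [NeZero L] [Fact (1 < L)] in
/-- The mask on a bond: `w_E(x, x + ê_k) = [(x, k) ∈ E]`. -/
theorem bondMask_shift (h4 : 4 ≤ L) (E : Finset (Edge 4 L)) (x : TorusSite 4 L) (k : Fin 4) :
    bondMask E x (Site.shift x k) = if (x, k) ∈ E then 1 else 0 := by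
  haveI : Fact (1 < L) := ⟨by omega⟩
  unfold bondMask
  refine if_congr ⟨fun h => h.1 k rfl, fun h => ⟨fun μ hμ => ?_, fun μ hμ => ?_⟩⟩ rfl rfl
  · rw [shift_eq_shift_iff] at hμ
    exact hμ ▸ h
  · exact absurd hμ.symm (shift_shift_ne_self h4 x k μ)

omit [NeZero L] [Fact (1 < L)] in
/-- The mask on the diagonal: `w_E(x, x) = 1`. -/
theorem bondMask_self (h4 : 4 ≤ L) (E : Finset (Edge 4 L)) (x : TorusSite 4 L) : bondMask E x x = 1 := by
  haveI : Fact (1 < L) := ⟨by omega⟩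
  unfold bondMask
  rw [if_pos]
  exact ⟨fun μ hμ => absurd hμ.symm (shift_ne_self x μ), fun μ hμ => absurd hμ.symm (shift_ne_self x μ)⟩

omit [Fact (1 < L)] in
/-- **Entries**: the masked operator has the masked entries of the undiluted one. -/
theorem sdOpE_apply (h4 : 4 ≤ L) (E : Finset (Edge 4 L)) (V : GaugeConfig 4 L (Matrix.unitaryGroup (Fin N) ℂ)) (m : ℝ)
    (p q : TorusSite 4 L × Fin N × Fin 4) :
    sdOpE E V m p q = bondMask E p.1 q.1 * sdOp V m p q := by
  have hf : ∀ k, (if (p.1, k) ∈ E then (1 : ℂ) else 0) * hopT V k p q = bondMask E p.1 q.1 * hopT V k p q := by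
    intro k
    simp only [hopT, Matrix.of_apply]
    by_cases h2 : q.1 = Site.shift p.1 k ∧ p.2.2 = q.2.2
    · have hm : bondMask E p.1 q.1 = if (p.1, k) ∈ E then 1 else 0 := by rw [h2.1, bondMask_shift h4]
      rw [hm, if_pos h2]
    · rw [if_neg h2, mul_zero, mul_zero]
  have hb : ∀ k, conj ((if (q.1, k) ∈ E then (1 : ℂ) else 0) * hopT V k q p) = bondMask E p.1 q.1 * conj (hopT V k q p) := by
    intro k
    simp only [hopT, Matrix.of_apply]
    by_cases h2 : p.1 = Site.shift q.1 k ∧ q.2.2 = p.2.2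
    · have hm : bondMask E p.1 q.1 = if (q.1, k) ∈ E then 1 else 0 := by
        rw [h2.1, bondMask_comm, bondMask_shift h4]
      rw [hm, if_pos h2, map_mul]
      congr 1
      split_ifs <;> simp
    · rw [if_neg h2, mul_zero, map_zero, mul_zero]
  have hd : (if p = q then (1 : ℂ) else 0) = bondMask E p.1 q.1 * (if p = q then 1 else 0) := by
    split_ifs with h
    · rw [h, bondMask_self h4, mul_one]
    · rw [mul_zero]
  rw [sdOp_eq]
  simp only [sdOpE, hopTE, bondDiag, Matrix.sub_apply, Matrix.smul_apply, Matrix.one_apply, Matrix.sum_apply,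
    Matrix.add_apply, conjTranspose_apply, smul_eq_mul, diagonal_mul, ← starRingEnd_apply]
  conv_lhs => rw [hd]
  simp_rw [hf, hb, ← mul_add, ← Finset.mul_sum]
  ring

end Hop

/-! ## Positivity of the masked plane block and of the diluted kernel -/

section Kernel

variable {L N : ℕ} [NeZero L] [Fact (1 < L)]

/-- **The masked plane block is a masked principal submatrix of `sdOpE E (apLift U) m`.** -/
theorem planeBlockE_eq (hL : Even L) (h4 : 4 ≤ L) (E : Finset (Edge 4 L))
    (U : GaugeConfig 4 L (Matrix.specialUnitaryGroup (Fin N) ℂ)) (m : ℝ) :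
    planeBlockE E U m = ((diagonal planeMask)ᴴ * sdOpE E (apLift U) m * diagonal planeMask).submatrix
      (upEnum L N) (upEnum L N) := by
  rw [planeBlockE, planeBlock_eq hL h4]
  ext i j
  simp only [Matrix.of_apply, Matrix.submatrix_apply, diagonal_conjTranspose, mul_diagonal, diagonal_mul,
    sdOpE_apply h4]
  ring

/-- **The masked plane block is positive semidefinite for `m ≥ -1`.** -/
theorem posSemidef_planeBlockE (hL : Even L) (h4 : 4 ≤ L) (E : Finset (Edge 4 L))
    (U : GaugeConfig 4 L (Matrix.specialUnitaryGroup (Fin N) ℂ)) {m : ℝ} (hm : -1 ≤ m) :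
    (planeBlockE E U m).PosSemidef := by
  rw [planeBlockE_eq hL h4]
  exact ((posSemidef_sdOpE E (apLift U) hm).conjTranspose_mul_mul_same _).submatrix _

end Kernel

/-- **The diluted Gram kernel is positive semidefinite for `m ≥ -1`.** -/
theorem posSemidef_gramKernelE {L N : ℕ} [NeZero L] [Fact (1 < L)] (hL : Even L) (h4 : 4 ≤ L)
    (E : Finset (Edge 4 L)) (U : GaugeConfig 4 L (Matrix.specialUnitaryGroup (Fin N) ℂ)) {m : ℝ} (hm : -1 ≤ m) :
    (gramKernelE E U m).PosSemidef :=
  (posSemidef_Gamma (posSemidef_planeBlockE hL h4 E U hm)).transpose.kronecker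
    (posSemidef_Gamma (posSemidef_planeBlockE hL h4 E U hm))

/-! ## Regularity and locality of the masked blocks -/

section Regularity

variable {L N : ℕ} [NeZero L] [Fact (1 < L)]

omit [Fact (1 < L)] in
/-- The masked upper block is continuous in the field. -/
theorem continuous_upperBlockE (E : Finset (Edge 4 L)) (m : ℝ) :
    Continuous fun U : GaugeConfig 4 L (Matrix.specialUnitaryGroup (Fin N) ℂ) => upperBlockE E U m :=
  continuous_matrix fun i j => continuous_const.mul ((continuous_upperBlock m).matrix_elem i j)

omit [Fact (1 < L)] in
/-- The masked plane block is continuous in the field. -/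
theorem continuous_planeBlockE (E : Finset (Edge 4 L)) (m : ℝ) :
    Continuous fun U : GaugeConfig 4 L (Matrix.specialUnitaryGroup (Fin N) ℂ) => planeBlockE E U m :=
  continuous_matrix fun i j => continuous_const.mul ((continuous_planeBlock m).matrix_elem i j)

/-- The masked upper block only depends on the links of the closed positive-time half. -/
theorem dependsOn_upperBlockE (hL : Even L) (h4 : 4 ≤ L) (E : Finset (Edge 4 L)) (m : ℝ) :
    DependsOn (fun U : GaugeConfig 4 L (Matrix.specialUnitaryGroup (Fin N) ℂ) => upperBlockE E U m)
      ((WilsonSiteRP.sitePosEdges ∪ WilsonSiteRP.sharedEdges : Finset (Edge 4 L)) : Set (Edge 4 L)) := by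
  intro U V hUV
  have h := dependsOn_upperBlock (N := N) hL h4 m hUV
  simp only at h
  ext i j
  simp only [upperBlockE, Matrix.of_apply, h]

/-- The masked plane block only depends on the shared links. -/
theorem dependsOn_planeBlockE (hL : Even L) (h4 : 4 ≤ L) (E : Finset (Edge 4 L)) (m : ℝ) :
    DependsOn (fun U : GaugeConfig 4 L (Matrix.specialUnitaryGroup (Fin N) ℂ) => planeBlockE E U m)
      ((WilsonSiteRP.sharedEdges : Finset (Edge 4 L)) : Set (Edge 4 L)) := by
  intro U V hUV
  have h := dependsOn_planeBlock (N := N) hL h4 m hUV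
  simp only at h
  ext i j
  simp only [planeBlockE, Matrix.of_apply, h]

end Regularity

end Summit.QuantumFields.QCD.Theorems.UnquenchedChessboardBoundLine

end
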